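import Mathlib
import Literature.Dynamics.Hamiltonian.KaloshinZhang2020.TheoremShapes
import Literature.Dynamics.Hamiltonian.KaloshinZhang2020.CuspSlices
import Literature.Dynamics.Hamiltonian.KaloshinZhang2020.GenericityClasses
import Literature.Dynamics.Hamiltonian.KaloshinZhang2020.GenericityClassesCounterexample

/-!
# Cheng–Xue 2023, §8.2: what the written ASSEMBLY of the genericity class yields, by target format (kernel-checked)

CITATION HEADER (lean-in-tree rule 2026-08-18). Source under adjudication: C.-Q. Cheng, J. Xue, *Arnold diffusion
for nearly integrable Hamiltonian systems*, Sci. China Math. **66** (2023) no. 8, 1649–1712,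
doi:10.1007/s11425-022-2118-1 (bib key `ChengXue2023`; the printed title per the Crossref deposit — the arXiv title
is *Arnold diffusion in nearly integrable Hamiltonian systems of arbitrary degrees of freedom*), read in the last
arXiv text arXiv:1503.04153v5 (`n-diffusion05082019.tex`, locators `l.NNNN`); the printed pages are not held by the
cell (acq-07835; acq-07792 was auto-fulfilled to the wrong paper). PROVENANCE NOTE (cell DIVERGENCE D31, litref g11,
2026-08-18): the printed reference list (Crossref, 43 entries) is the v5 bibliography minus 13 and plus 8 entries,
so the print is a REVISION of v5 and not v5 verbatim; the paragraph quoted below is v5's, and its printed form is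
unverified until the pages are held. THIS IS A
CLAIMED RESULT UNDER ADJUDICATION by the pub-arnold near-miss cell: nothing in this file asserts or uses any
statement of that paper as a fact. What is reproduced is ONLY THE FORMAT of the data produced by the assembly
paragraph §8.2 l.2183–2187 (structure `AssemblyData` below, an abstraction recorded in the cell's DIVERGENCE.md),
and what is PROVED is point-set topology about that format, relative to the typed genericity classes of
`KaloshinZhang2020/TheoremShapes.lean` (`KZCuspGeneric` = Kaloshin–Zhang, Ann. of Math. Stud. 208 (2020) Thm 1.2,
bib key `KaloshinZhang2020`; `CXCuspResidual` = the 2013/2015/CJM 2017/AJM 2019 wording "ℜ residual";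
`CXCuspOpenDense` = the v5 / 2023 wording "ℜ open-dense", v5 l.208). Cell records: LEMMAS §3 G8′ and §3.X AF1/AF1′/
AF1″, claim row C36, GAPS 2026-08-18T18:45Z (litref g9), 19:00Z (litref g10), 18:58Z (typer g6).

THE PARAGRAPH (v5 l.2183–2187, verbatim where quoted). "Denote by 𝒪 ⊂ 𝔅₁ the open-dense set obtained by taking
intersection of the finitely many open-dense sets. We choose a P ∈ 𝒪 such that the finitely many conditions are
satisfied. This P determines ε_P such that for ε < ε_P Proposition [PropComplete] holds … we fix an ε and apply
the argument in Section 7 of [CY1], which gives us an ε′ = ε′(εP) and an open-dense set ℜ_{ε′}(εP) ⊂ 𝔅_{ε′} such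
that part (3.b) holds for ε(P + P′) for any εP′ ∈ ℜ_{ε′}(εP). … Finally, applying Karatowski-Ulam Theorem [ThmKU]
to the set ∪_{P ∈ 𝒪} ∪_{ε < ε_P} ℜ_{ε′}(εP), we get that there exists an open-dense set ℜ ⊂ 𝔖₁ such that for each
P ∈ ℜ there exist ε_P and a residual set R_P ⊂ (0, ε_P) such that the theorem holds for all εP for ε ∈ R_P and
P ∈ ℜ." ([ThmKU] = Oxtoby, *Measure and Category*, Thm 15.1, quoted at v5 l.1402–1404, whose conclusion is "for
all x except a set of first category".)

THE ABSTRACTION (`AssemblyData Good`, directions read on the unit sphere): an open dense set `dirs` (= 𝒪 ∩ 𝔖₁) of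
unit directions; a height `height P` (= ε_P), positive on `dirs`, with NO regularity; an OPEN set `goodSet`
(= ⋃_{P ∈ 𝒪, ε < ε_P} (εP + ℜ_{ε′}(εP)), a union of sets open in `Pert`) all of whose members are good; and
accumulation of `goodSet` at every `t • P` with `P ∈ dirs`, `0 < t < height P` (each translate
`εP + ℜ_{ε′}(εP)` is open-dense in the ball of radius `ε′` about `εP`). Nothing else of the paragraph is retained;
in particular nothing Hamiltonian, and (S) below is the shape of what MORE one could ask of [CY1] §7.

WHAT IS PROVED (all kernel-checked, tagged [folklore]; (A)–(C) are the cell's "repair census by target format"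
for the audit focus AF1″):
* (A) `AssemblyData.cxCuspResidual`: the data ALONE give the 2013/2015 class `CXCuspResidual a Good` for every
  `a > 0` — indeed for residually many unit directions the good amplitudes contain an OPEN dense subset of
  `(0, min (a, ε_P))`. This is the abstract slice lemma L-gen-1 (`residual_setOf_slice_dense`, `CuspSlices.lean`)
  transported along the cone map `(t, P) ↦ t • P` (Mathlib `IsOpen.smul_sphere`); NO hypothesis on `P ↦ ε_P`.
  So the assembly AS WRITTEN supports the residual-ℜ statements (2015 text; Cheng CJM 2017; AJM 2019).
* (B) `AssemblyData.kzCuspGeneric`: if in addition the height is LOCALLY BOUNDED BELOW on `dirs`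
  (`AssemblyData.LocallyBounded`: every `P ∈ dirs` has a `c > 0` with `c ≤ ε_Q` for all `Q` near `P` — the natural
  but UNWRITTEN output of "finitely many open conditions"; cell AF1′: v5 states no regularity of `P ↦ ε_P`), then
  the Kaloshin–Zhang class `KZCuspGeneric (↑dirs) Good` holds: a lower semicontinuous minorant `ε₀` of the height is
  built as a supremum over open neighbourhoods (`AssemblyData.eps0`), the cusp over it is accumulated by `goodSet`,
  and `goodSet ∩ cusp` is relatively open and dense in the cusp (cone openness again).
* (B′) `assemblyData_of_kzCuspGeneric`: conversely EVERY Kaloshin–Zhang witness is such assembly data with the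
  local bound (uses `isOpen_cusp`: the KZ cusp over a relatively open direction set and a lower semicontinuous
  height is open in `Pert`). Hence "v5 assembly data + local lower bound" and "KZ20's genericity class" are the
  SAME class (`kzCuspGeneric_iff_assemblyData`).
* (C) `exists_assemblyData_locallyBounded_not_cxCuspOpenDense`: consequently the data — even with the local
  bound — do NOT give the printed v5 class `CXCuspOpenDense` in any finite-dimensional real normed space of
  dimension ≥ 2 (by (B′) and the accepted counterexample `exists_kzCuspGeneric_not_cxCuspOpenDense`,
  `GenericityClassesCounterexample.lean`, litref g10, whose good set is open and dense in the punctured unit ball).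
* (S) `AssemblyData.cxCuspOpenDense_of_raywise`: the input that WOULD give the printed class with `ℜ = dirs` is
  RAY-WISE — for EVERY `P ∈ dirs` the good amplitudes are residual in `[0, b]` for `0 < b ≤ ε_P` — a statement about
  each one-parameter family `ε ↦ εP`; it is recorded here only to fix its quantifier shape (the proof is
  definitional). Kuratowski–Ulam delivers residually many such `P` (that is (A)), not all `P` in an open set, and
  genericity by correction inside a ball `𝔅_{ε′}` around `εP` says nothing about the segment `{εP}` itself.
READING (cell verdict shape for AF1″; a statement about formats, not about Hamiltonian dynamics): the residual-ℜ
clause (2015 / CJM 2017 / AJM 2019 wording) follows from the data the paragraph produces (A); granting the unwritten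
local bound (l*), so does the Kaloshin–Zhang-format clause (B), and "assembly data + (l*)" is exactly the
Kaloshin–Zhang class (B′); the open-dense-ℜ clause actually printed in v5 / 2023 does NOT follow from these data in
any finite-dimensional normed space of dimension ≥ 2 (C) — an additional ray-wise input of shape (S), absent from
the text, would be needed. Which clause the downstream uses is recorded in the cell's LEMMAS §3 G8′ / AF1″.
-/

open Set Filter Topology
open scoped Pointwise

namespace Literature.Dynamics.Hamiltonian.ChengXue2023

open Literature.Dynamics.Hamiltonian.KaloshinZhang2020

variable {Pert : Type} [NormedAddCommGroup Pert] [NormedSpace ℝ Pert]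

/-- **The data produced by the v5 assembly paragraph (§8.2, l.2183–2187), abstracted.** `dirs` = the open-dense set
𝒪 of directions satisfying the finitely many non-degeneracy conditions (read on the unit sphere 𝔖₁; v5 writes
𝒪 ⊂ 𝔅₁); `height P` = ε_P ("This P determines ε_P such that for ε < ε_P Proposition PropComplete holds", no
regularity in `P` stated or assumed); `goodSet` = ⋃_{P ∈ 𝒪, ε < ε_P} (εP + ℜ_{ε′}(εP)), the union of the
open(-dense-in-a-ball) sets of corrected perturbations for which the conclusion holds — an OPEN set of good
perturbations; `mem_closure` = each translate εP + ℜ_{ε′}(εP) is (open-)dense in the ball of radius ε′ about εP, so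
`goodSet` accumulates at εP. A claim's bookkeeping vocabulary, not a fact; nothing Hamiltonian is retained.
[cite: ChengXue2023, §8.2 = proof of Theorem `ThmMainNHIC` (arXiv v5 l.2183–2187)] -/
structure AssemblyData (Good : Pert → Prop) where
  /-- the open-dense set `𝒪` of good directions, on the unit sphere -/
  dirs : Set (unitSphere Pert)
  isOpen_dirs : IsOpen dirs
  dense_dirs : Dense dirs
  /-- `ε_P` -/
  height : unitSphere Pert → ℝ
  height_pos : ∀ P ∈ dirs, 0 < height P
  /-- the union `W` of the corrected good sets `εP + ℜ_{ε′}(εP)` -/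
  goodSet : Set Pert
  isOpen_goodSet : IsOpen goodSet
  good_of_mem : ∀ v ∈ goodSet, Good v
  /-- `W` accumulates at every `εP`, `P ∈ 𝒪`, `0 < ε < ε_P` -/
  mem_closure : ∀ P ∈ dirs, ∀ t : ℝ, 0 < t → t < height P → t • (P : Pert) ∈ closure goodSet

namespace AssemblyData

variable {Good : Pert → Prop}

/-- **Cone openness, pulled back.** If `t • P` (`t > 0`, `P` a unit direction) lies in the closure of an open set
`W ⊆ Pert`, then `(t, P)` lies in the closure of the preimage `{(s, Q) | s • Q ∈ W} ⊆ ℝ × 𝔖₁`: the cone map is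
OPEN on `(0, ∞) × 𝔖₁` (Mathlib `IsOpen.smul_sphere`). [folklore] -/
theorem mem_closure_conePreimage {W : Set Pert} {t : ℝ} (ht : 0 < t) {P : unitSphere Pert}
    (h : t • (P : Pert) ∈ closure W) :
    (t, P) ∈ closure {q : ℝ × unitSphere Pert | q.1 • (q.2 : Pert) ∈ W} := by
  rw [mem_closure_iff]
  intro o ho hmem
  obtain ⟨u, v, hu, hv, htu, hPv, huv⟩ := isOpen_prod_iff.mp ho t P hmem
  set I : Set ℝ := u ∩ Ioi 0 with hI
  have hIopen : IsOpen I := hu.inter isOpen_Ioi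
  have hI0 : (0 : ℝ) ∉ I := fun h0 => lt_irrefl (0 : ℝ) h0.2
  have htI : t ∈ I := ⟨htu, ht⟩
  have hcone : IsOpen (I • (Subtype.val '' v : Set Pert)) := IsOpen.smul_sphere one_ne_zero hIopen hI0 hv
  have hmemcone : t • (P : Pert) ∈ I • (Subtype.val '' v : Set Pert) :=
    Set.smul_mem_smul htI ⟨P, hPv, rfl⟩
  obtain ⟨w, hwcone, hwW⟩ := mem_closure_iff.mp h _ hcone hmemcone
  obtain ⟨μ, hμI, y, ⟨Q, hQv, rfl⟩, rfl⟩ := Set.mem_smul.mp hwcone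
  exact ⟨(μ, Q), huv (mk_mem_prod hμI.1 hQv), hwW⟩

/-- **(A) The assembly data ALONE give the 2013/2015 class (ℜ RESIDUAL), for every `a > 0`** — with, for residually
many unit directions `P`, an OPEN dense set of good amplitudes in `(0, min (a, ε_P))`. L-gen-1 on the cone; no
hypothesis on `P ↦ ε_P`. [folklore] -/
theorem cxCuspResidual (D : AssemblyData Good) {a : ℝ} (ha : 0 < a) : CXCuspResidual a Good := by
  classical
  -- height `a' = min a ε_P` on `𝒪`, `0` elsewhere; `O'` = cone preimage of the open good set
  let a' : unitSphere Pert → ℝ := fun P => if P ∈ D.dirs then min a (D.height P) else 0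
  let O' : Set (ℝ × unitSphere Pert) := {q | q.1 • (q.2 : Pert) ∈ D.goodSet}
  have hO'open : IsOpen O' :=
    D.isOpen_goodSet.preimage (by fun_prop : Continuous fun q : ℝ × unitSphere Pert => q.1 • (q.2 : Pert))
  -- the cusp over `a'` lies in the closure of `O'`
  have hWd : cuspSet a' ⊆ closure O' := by
    rintro ⟨l, P⟩ ⟨hl0, hla⟩
    dsimp only at hl0 hla
    have hP : P ∈ D.dirs := by
      by_contra hP
      have h0 : a' P = 0 := by simp [a', hP]
      linarith
    have hla' : l < min a (D.height P) := by simpa [a', hP] using hla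
    have hlε : l < D.height P := lt_of_lt_of_le hla' (min_le_right _ _)
    exact mem_closure_conePreimage hl0 (D.mem_closure P hP l hl0 hlε)
  -- L-gen-1: residually many directions with a dense amplitude slice of `O'`
  have hres := residual_setOf_slice_dense a' O' hO'open hWd
  have hdirs : D.dirs ∈ residual (unitSphere Pert) := residual_of_dense_open D.isOpen_dirs D.dense_dirs
  refine ⟨_, inter_mem hres hdirs, ?_⟩
  rintro P ⟨hPres, hP⟩
  have haP : a' P = min a (D.height P) := by simp [a', hP]
  have haP0 : 0 < min a (D.height P) := lt_min ha (D.height_pos P hP)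
  have hRsub : slice O' P ∩ Ioo 0 (min a (D.height P)) ⊆ Icc 0 (min a (D.height P)) :=
    fun t ht => Ioo_subset_Icc_self ht.2
  have hRopen : IsOpen (slice O' P ∩ Ioo 0 (min a (D.height P))) :=
    (isOpen_slice hO'open P).inter isOpen_Ioo
  have hRcl : Icc 0 (min a (D.height P)) ⊆ closure (slice O' P ∩ Ioo 0 (min a (D.height P))) := by
    have h1 : Ioo 0 (min a (D.height P)) ⊆ closure (slice O' P ∩ Ioo 0 (min a (D.height P))) := by
      have h2 : Ioo 0 (a' P) ⊆ closure (slice O' P ∩ Ioo 0 (a' P)) := hPres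
      rwa [haP] at h2
    calc Icc 0 (min a (D.height P)) = closure (Ioo 0 (min a (D.height P))) := (closure_Ioo haP0.ne).symm
      _ ⊆ closure (slice O' P ∩ Ioo 0 (min a (D.height P))) := closure_minimal h1 isClosed_closure
  refine ⟨min a (D.height P), haP0, min_le_left _ _, slice O' P ∩ Ioo 0 (min a (D.height P)), hRsub, ?_, ?_⟩
  · refine residual_of_dense_open (hRopen.preimage continuous_subtype_val) ?_
    rw [Subtype.dense_iff, Subtype.image_preimage_coe]
    exact hRcl.trans (closure_mono fun t ht => ⟨hRsub ht, ht⟩)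
  · rintro t ⟨ht, -, -⟩
    have ht' : t • (P : Pert) ∈ D.goodSet := ht
    exact D.good_of_mem _ ht'

/-- **The local lower bound (l*)** on the height: every good direction `P ∈ 𝒪` has a constant `c > 0` with
`c ≤ ε_Q` for all directions `Q` near `P`. The form in which "ε_P is determined by finitely many OPEN conditions
with quantitative constants" would deliver regularity of `P ↦ ε_P`; NOT stated in arXiv:1503.04153v5 (cell AF1′).
Equivalent, for the purposes below, to the existence of a lower semicontinuous minorant positive on `𝒪`
(`eps0`, `eps0_pos`, `lt_height_of_lt_eps0`). [folklore] -/
def LocallyBounded (D : AssemblyData Good) : Prop :=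
  ∀ P ∈ D.dirs, ∃ c : ℝ, 0 < c ∧ ∀ᶠ Q in 𝓝 P, c ≤ D.height Q

/-- The admissible local lower bounds at an ambient point `v`: constants `c ∈ (0, 1]` that bound the height from
below on (the unit directions inside) some open neighbourhood of `v` contained direction-wise in `𝒪`. The cap
`c ≤ 1` only keeps the set bounded. [folklore] -/
def lowerBoundSet (D : AssemblyData Good) (v : Pert) : Set ℝ :=
  {c | 0 < c ∧ c ≤ 1 ∧ ∃ V : Set Pert, IsOpen V ∧ v ∈ V ∧
    ∀ Q : unitSphere Pert, (Q : Pert) ∈ V → Q ∈ D.dirs ∧ c ≤ D.height Q}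

/-- **The lower semicontinuous minorant** `ε₀(v) = sup` of the admissible local lower bounds at `v` (`= 0` if there
are none) — the abstract form of Kaloshin–Zhang's "ε₀ = sup of lower semicontinuous functions is lower
semicontinuous" (arXiv:1212.1150v3 `diffusion-scheme.tex` l.711–719). [folklore] -/
noncomputable def eps0 (D : AssemblyData Good) (v : Pert) : ℝ :=
  sSup (D.lowerBoundSet v)

/-- The admissible local lower bounds are bounded above (by `1`). [folklore] -/
theorem lowerBoundSet_bddAbove (D : AssemblyData Good) (v : Pert) : BddAbove (D.lowerBoundSet v) :=
  ⟨1, fun _ hc => hc.2.1⟩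

/-- `ε₀ ≥ 0` everywhere. [folklore] -/
theorem eps0_nonneg (D : AssemblyData Good) (v : Pert) : 0 ≤ D.eps0 v :=
  Real.sSup_nonneg fun _ hc => hc.1.le

/-- `ε₀` is lower semicontinuous on all of `Pert`: a witness neighbourhood for `c ∈ lowerBoundSet v` is a witness
for every point of itself. [folklore] -/
theorem eps0_lowerSemicontinuous (D : AssemblyData Good) : LowerSemicontinuous D.eps0 := by
  rw [lowerSemicontinuous_iff_isOpen_preimage]
  intro y
  rw [isOpen_iff_mem_nhds]
  intro v hv
  have hv' : y < D.eps0 v := hv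
  by_cases hy : y < 0
  · exact Filter.univ_mem' fun w => show y < D.eps0 w from lt_of_lt_of_le hy (D.eps0_nonneg w)
  · have hy' : 0 ≤ y := not_lt.mp hy
    have hne : (D.lowerBoundSet v).Nonempty := by
      by_contra hne
      rw [Set.not_nonempty_iff_eq_empty] at hne
      have : D.eps0 v = 0 := by simp [eps0, hne, Real.sSup_empty]
      linarith
    obtain ⟨c, hc, hyc⟩ := exists_lt_of_lt_csSup hne hv'
    obtain ⟨hc0, hc1, V, hVopen, hvV, hV⟩ := hc
    refine Filter.mem_of_superset (hVopen.mem_nhds hvV) fun w hwV => ?_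
    have hcw : c ∈ D.lowerBoundSet w := ⟨hc0, hc1, V, hVopen, hwV, hV⟩
    show y < D.eps0 w
    exact lt_of_lt_of_le hyc (le_csSup (D.lowerBoundSet_bddAbove w) hcw)

/-- Under (l*), `ε₀` is positive on `𝒪`. [folklore] -/
theorem eps0_pos (D : AssemblyData Good) (hl : D.LocallyBounded) (P : unitSphere Pert) (hP : P ∈ D.dirs) :
    0 < D.eps0 P := by
  obtain ⟨c, hc0, hev⟩ := hl P hP
  have hmem : {Q : unitSphere Pert | Q ∈ D.dirs ∧ c ≤ D.height Q} ∈ 𝓝 P :=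
    Filter.inter_mem (D.isOpen_dirs.mem_nhds hP) hev
  obtain ⟨u, hu, huset⟩ := (mem_nhds_subtype _ P _).mp hmem
  obtain ⟨V, hVu, hVopen, hPV⟩ := mem_nhds_iff.mp hu
  have hc' : min c 1 ∈ D.lowerBoundSet (P : Pert) := by
    refine ⟨lt_min hc0 one_pos, min_le_right _ _, V, hVopen, hPV, fun Q hQ => ?_⟩
    have hQ' : Q ∈ {Q : unitSphere Pert | Q ∈ D.dirs ∧ c ≤ D.height Q} := huset (hVu hQ)
    exact ⟨hQ'.1, (min_le_left _ _).trans hQ'.2⟩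
  exact lt_of_lt_of_le (lt_min hc0 one_pos) (le_csSup (D.lowerBoundSet_bddAbove _) hc')

/-- `ε₀` is a minorant of the height: an amplitude below `ε₀ P` is below `ε_P` (and `P ∈ 𝒪`). [folklore] -/
theorem lt_height_of_lt_eps0 (D : AssemblyData Good) {P : unitSphere Pert} {t : ℝ} (ht0 : 0 < t)
    (ht : t < D.eps0 P) : P ∈ D.dirs ∧ t < D.height P := by
  have hne : (D.lowerBoundSet (P : Pert)).Nonempty := by
    by_contra hne
    rw [Set.not_nonempty_iff_eq_empty] at hne
    have : D.eps0 P = 0 := by simp [eps0, hne, Real.sSup_empty]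
    linarith
  obtain ⟨c, ⟨-, -, V, -, hPV, hV⟩, htc⟩ := exists_lt_of_lt_csSup hne ht
  obtain ⟨hPd, hcP⟩ := hV P hPV
  exact ⟨hPd, lt_of_lt_of_le htc hcP⟩

/-- The direction set of the Kaloshin–Zhang witness: `𝒪` read in `Pert`. [folklore] -/
theorem openDenseIn_dirs (D : AssemblyData Good) :
    OpenDenseIn (Subtype.val '' D.dirs : Set Pert) (unitSphere Pert) := by
  refine ⟨by rintro _ ⟨P, -, rfl⟩; exact P.2, ?_, ?_⟩
  · rw [Subtype.val_injective.preimage_image]; exact D.isOpen_dirs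
  · rw [Subtype.val_injective.preimage_image]; exact D.dense_dirs

/-- **(B) Assembly data + local lower bound (l*) ⟹ the Kaloshin–Zhang class**, with `𝒰 = 𝒪`, the lower
semicontinuous minorant `ε₀` of `ε_P` as the cusp height, and `𝒲 = goodSet ∩ 𝒱(𝒪, ε₀)`. [folklore] -/
theorem kzCuspGeneric (D : AssemblyData Good) (hl : D.LocallyBounded) :
    KZCuspGeneric (Subtype.val '' D.dirs : Set Pert) Good := by
  classical
  refine ⟨D.openDenseIn_dirs, D.eps0, D.eps0_lowerSemicontinuous, D.eps0_nonneg, ?_, ?_⟩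
  · rintro _ ⟨P, hP, rfl⟩
    exact D.eps0_pos hl P hP
  refine ⟨D.goodSet ∩ cusp (Subtype.val '' D.dirs) D.eps0, ⟨inter_subset_right, ?_, ?_⟩,
    fun v hv => D.good_of_mem v hv.1⟩
  · -- relatively open: the trace of the open set `goodSet`
    have : (Subtype.val ⁻¹' (D.goodSet ∩ cusp (Subtype.val '' D.dirs) D.eps0) :
        Set (cusp (Subtype.val '' D.dirs) D.eps0)) = Subtype.val ⁻¹' D.goodSet := by
      ext ⟨v, hv⟩
      simp only [mem_preimage, mem_inter_iff]
      exact ⟨fun h => h.1, fun h => ⟨h, hv⟩⟩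
    rw [this]
    exact D.isOpen_goodSet.preimage continuous_subtype_val
  · -- relatively dense: every point of the cusp is accumulated by `goodSet ∩ cusp`
    rw [Subtype.dense_iff, Subtype.image_preimage_coe]
    rintro v ⟨H₁, hH₁, t, ht0, htε, rfl⟩
    obtain ⟨P, hPd, rfl⟩ : H₁ ∈ Subtype.val '' D.dirs := hH₁
    obtain ⟨-, htP⟩ := D.lt_height_of_lt_eps0 ht0 htε
    have hcl : t • (P : Pert) ∈ closure D.goodSet := D.mem_closure P hPd t ht0 htP
    rw [mem_closure_iff]
    intro o ho hmem
    -- room below `ε₀` near `P`, by lower semicontinuity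
    obtain ⟨c₁, htc₁, hc₁⟩ := exists_between htε
    have hU₁ : IsOpen (D.eps0 ⁻¹' Ioi c₁) := D.eps0_lowerSemicontinuous.isOpen_preimage c₁
    -- a product box inside `o` around `(t, P)`
    have hpre : IsOpen {q : ℝ × unitSphere Pert | q.1 • (q.2 : Pert) ∈ o} :=
      ho.preimage (by fun_prop : Continuous fun q : ℝ × unitSphere Pert => q.1 • (q.2 : Pert))
    obtain ⟨u, w, hu, hw, htu, hPw, huw⟩ := isOpen_prod_iff.mp hpre t P hmem
    set I : Set ℝ := u ∩ Ioo 0 c₁ with hI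
    have hIopen : IsOpen I := hu.inter isOpen_Ioo
    have hI0 : (0 : ℝ) ∉ I := fun h0 => lt_irrefl (0 : ℝ) h0.2.1
    have htI : t ∈ I := ⟨htu, ht0, htc₁⟩
    set V : Set (unitSphere Pert) := w ∩ D.dirs ∩ Subtype.val ⁻¹' (D.eps0 ⁻¹' Ioi c₁) with hV
    have hVopen : IsOpen V := (hw.inter D.isOpen_dirs).inter (hU₁.preimage continuous_subtype_val)
    have hPV : P ∈ V := ⟨⟨hPw, hPd⟩, hc₁⟩
    have hcone : IsOpen (I • (Subtype.val '' V : Set Pert)) := IsOpen.smul_sphere one_ne_zero hIopen hI0 hVopen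
    have hmemcone : t • (P : Pert) ∈ I • (Subtype.val '' V : Set Pert) :=
      Set.smul_mem_smul htI ⟨P, hPV, rfl⟩
    obtain ⟨x, hxcone, hxW⟩ := mem_closure_iff.mp hcl _ hcone hmemcone
    obtain ⟨μ, hμI, y, ⟨Q, hQV, rfl⟩, rfl⟩ := Set.mem_smul.mp hxcone
    have hμ0 : 0 < μ := hμI.2.1
    have hμc₁ : μ < c₁ := hμI.2.2
    have hQw : Q ∈ w := hQV.1.1
    have hQd : Q ∈ D.dirs := hQV.1.2
    have hQε : c₁ < D.eps0 (Q : Pert) := hQV.2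
    have hxo : μ • (Q : Pert) ∈ o := huw (mk_mem_prod hμI.1 hQw)
    have hxcusp : μ • (Q : Pert) ∈ cusp (Subtype.val '' D.dirs) D.eps0 :=
      ⟨(Q : Pert), ⟨Q, hQd, rfl⟩, μ, hμ0, lt_trans hμc₁ hQε, rfl⟩
    exact ⟨μ • (Q : Pert), hxo, hxcusp, hxW, hxcusp⟩

end AssemblyData

/-- **The Kaloshin–Zhang cusp is open** in `Pert` when the direction set is relatively open in the sphere and the
height is lower semicontinuous (the point of building `ε₀` lower semicontinuous, arXiv:1212.1150v3 l.711–719; the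
cell's `isOpen_cuspSet` is the same fact in polar coordinates). [folklore] -/
theorem isOpen_cusp {𝒰 : Set Pert} (h𝒰sub : 𝒰 ⊆ unitSphere Pert)
    (h𝒰open : IsOpen (Subtype.val ⁻¹' 𝒰 : Set (unitSphere Pert))) {ε₀ : Pert → ℝ}
    (hε₀ : LowerSemicontinuous ε₀) : IsOpen (cusp 𝒰 ε₀) := by
  rw [isOpen_iff_mem_nhds]
  rintro v ⟨H₁, hH₁, t, ht0, htε, rfl⟩
  obtain ⟨c₁, htc₁, hc₁⟩ := exists_between htε
  have hU₁ : IsOpen (ε₀ ⁻¹' Ioi c₁) := hε₀.isOpen_preimage c₁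
  set V : Set (unitSphere Pert) := Subtype.val ⁻¹' 𝒰 ∩ Subtype.val ⁻¹' (ε₀ ⁻¹' Ioi c₁) with hV
  have hVopen : IsOpen V := h𝒰open.inter (hU₁.preimage continuous_subtype_val)
  have hPV : (⟨H₁, h𝒰sub hH₁⟩ : unitSphere Pert) ∈ V := ⟨hH₁, hc₁⟩
  have hI0 : (0 : ℝ) ∉ Ioo 0 c₁ := fun h0 => lt_irrefl (0 : ℝ) h0.1
  have hcone : IsOpen (Ioo 0 c₁ • (Subtype.val '' V : Set Pert)) :=
    IsOpen.smul_sphere one_ne_zero isOpen_Ioo hI0 hVopen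
  have hmem : t • H₁ ∈ Ioo 0 c₁ • (Subtype.val '' V : Set Pert) :=
    Set.smul_mem_smul ⟨ht0, htc₁⟩ ⟨⟨H₁, h𝒰sub hH₁⟩, hPV, rfl⟩
  refine Filter.mem_of_superset (hcone.mem_nhds hmem) ?_
  intro x hx
  obtain ⟨μ, hμ, y, ⟨Q, hQV, rfl⟩, rfl⟩ := Set.mem_smul.mp hx
  have hQ𝒰 : (Q : Pert) ∈ 𝒰 := hQV.1
  have hQε : c₁ < ε₀ (Q : Pert) := hQV.2
  exact ⟨(Q : Pert), hQ𝒰, μ, hμ.1, lt_trans hμ.2 hQε, rfl⟩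

/-- **(B′) Every Kaloshin–Zhang witness IS assembly data with the local lower bound**: `𝒪 = 𝒰`, `ε_P = ε₀`,
`goodSet = 𝒲` (open in `Pert` because the cusp is, `isOpen_cusp`), accumulation = density of `𝒲` in the cusp,
local bound = lower semicontinuity of a positive `ε₀`. [folklore] -/
theorem assemblyData_of_kzCuspGeneric
    {𝒰 : Set Pert} {Good : Pert → Prop} (h : KZCuspGeneric 𝒰 Good) :
    ∃ D : AssemblyData Good, D.LocallyBounded ∧ (Subtype.val '' D.dirs : Set Pert) = 𝒰 := by
  classical
  obtain ⟨h𝒰sub, h𝒰open, h𝒰dense⟩ := h.openDense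
  obtain ⟨ε₀, hlsc, -, hε₀pos, 𝒲, ⟨h𝒲sub, h𝒲open, h𝒲dense⟩, hgood⟩ := h.exists_eps
  obtain ⟨O, hOopen, hO⟩ := isOpen_induced_iff.mp h𝒲open
  have hOW : ∀ v ∈ cusp 𝒰 ε₀, v ∈ O ↔ v ∈ 𝒲 := by
    intro v hv
    have h1 := Set.ext_iff.mp hO ⟨v, hv⟩
    simpa using h1
  have h𝒲cl : cusp 𝒰 ε₀ ⊆ closure 𝒲 := by
    have h1 := Subtype.dense_iff.mp h𝒲dense
    rw [Subtype.image_preimage_coe] at h1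
    exact h1.trans (closure_mono inter_subset_right)
  have hcuspopen : IsOpen (cusp 𝒰 ε₀) := isOpen_cusp h𝒰sub h𝒰open hlsc
  have h𝒲eq : O ∩ cusp 𝒰 ε₀ = 𝒲 := by
    ext v
    constructor
    · rintro ⟨hvO, hvc⟩
      exact (hOW v hvc).mp hvO
    · intro hv
      exact ⟨(hOW v (h𝒲sub hv)).mpr hv, h𝒲sub hv⟩
  refine ⟨⟨Subtype.val ⁻¹' 𝒰, h𝒰open, h𝒰dense, fun P => ε₀ P, fun P hP => hε₀pos (P : Pert) hP,
    O ∩ cusp 𝒰 ε₀, hOopen.inter hcuspopen, fun v hv => hgood v ((Set.ext_iff.mp h𝒲eq v).mp hv),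
    fun P hP t ht0 htε => ?_⟩, ?_, ?_⟩
  · -- accumulation = density of `𝒲` in the cusp
    rw [h𝒲eq]
    exact h𝒲cl ⟨P, hP, t, ht0, htε, rfl⟩
  · -- local lower bound from lower semicontinuity of a positive `ε₀`
    intro P hP
    have hP' : (P : Pert) ∈ 𝒰 := hP
    have hpos : 0 < ε₀ P := hε₀pos _ hP'
    refine ⟨ε₀ P / 2, by linarith, ?_⟩
    have hev : ∀ᶠ v in 𝓝 (P : Pert), ε₀ P / 2 < ε₀ v := hlsc (P : Pert) (ε₀ P / 2) (by linarith)
    have hev' : ∀ᶠ Q : unitSphere Pert in 𝓝 P, ε₀ P / 2 < ε₀ (Q : Pert) :=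
      Filter.Tendsto.eventually (f := (Subtype.val : unitSphere Pert → Pert))
        (p := fun v => ε₀ P / 2 < ε₀ v) continuous_subtype_val.continuousAt hev
    exact hev'.mono fun Q hQ => hQ.le
  · -- the direction set is `𝒰` again
    show Subtype.val '' (Subtype.val ⁻¹' 𝒰 : Set (unitSphere Pert)) = 𝒰
    rw [Subtype.image_preimage_coe]
    exact inter_eq_right.mpr h𝒰sub

/-- **Assembly data with the local bound and the Kaloshin–Zhang class are the same class** (directions fixed).
[folklore] -/
theorem kzCuspGeneric_iff_assemblyData {𝒰 : Set Pert} {Good : Pert → Prop} :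
    KZCuspGeneric 𝒰 Good ↔
      ∃ D : AssemblyData Good, D.LocallyBounded ∧ (Subtype.val '' D.dirs : Set Pert) = 𝒰 := by
  constructor
  · exact fun h => assemblyData_of_kzCuspGeneric h
  · rintro ⟨D, hl, rfl⟩
    exact D.kzCuspGeneric hl

/-- **(C) The assembly data do NOT give the printed v5 class**, even with the local bound: in every
finite-dimensional real normed space of dimension ≥ 2 there are `Good` and assembly data for it, locally bounded,
with `CXCuspResidual a Good` for all `a > 0` and `¬ CXCuspOpenDense a Good` for all `a`. (From (B′) and the
accepted counterexample `exists_kzCuspGeneric_not_cxCuspOpenDense`.) [folklore] -/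
theorem exists_assemblyData_locallyBounded_not_cxCuspOpenDense [FiniteDimensional ℝ Pert]
    (h2 : 2 ≤ Module.finrank ℝ Pert) :
    ∃ (Good : Pert → Prop) (D : AssemblyData Good), D.LocallyBounded ∧
      (∀ a : ℝ, 0 < a → CXCuspResidual a Good) ∧ ∀ a : ℝ, ¬ CXCuspOpenDense a Good := by
  obtain ⟨𝒰, Good, hKZ, hres, hnot⟩ := exists_kzCuspGeneric_not_cxCuspOpenDense (Pert := Pert) h2
  obtain ⟨D, hl, -⟩ := assemblyData_of_kzCuspGeneric hKZ
  exact ⟨Good, D, hl, hres, hnot⟩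

namespace AssemblyData

variable {Good : Pert → Prop}

/-- **(S) The ray-wise input that WOULD give the printed class, with `ℜ = 𝒪`**: if for EVERY direction `P ∈ 𝒪` and
every `0 < b ≤ ε_P` the good amplitudes are residual in `[0, b]`, then `CXCuspOpenDense a Good` for every `a > 0`.
Definitional packaging — recorded to fix the quantifier shape of the missing input: a statement about each
one-parameter family `ε ↦ εP`, for all `P` in an open set (contrast (A): residually many `P`). [folklore] -/
theorem cxCuspOpenDense_of_raywise (D : AssemblyData Good) {a : ℝ} (ha : 0 < a)
    (hS : ∀ P ∈ D.dirs, ∀ b : ℝ, 0 < b → b ≤ D.height P →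
      (Subtype.val ⁻¹' {t : ℝ | Good (t • (P : Pert))} : Set (Icc (0 : ℝ) b)) ∈ residual (Icc (0 : ℝ) b)) :
    CXCuspOpenDense a Good := by
  refine ⟨D.dirs, D.isOpen_dirs, D.dense_dirs, fun P hP => ?_⟩
  have hb0 : 0 < min a (D.height P) := lt_min ha (D.height_pos P hP)
  refine ⟨min a (D.height P), hb0, min_le_left _ _,
    {t : ℝ | Good (t • (P : Pert))} ∩ Icc 0 (min a (D.height P)), inter_subset_right, ?_, fun t ht => ht.1⟩
  exact Filter.mem_of_superset (hS P hP (min a (D.height P)) hb0 (min_le_right _ _))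
    fun x hx => ⟨hx, x.2⟩

end AssemblyData

end Literature.Dynamics.Hamiltonian.ChengXue2023
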